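import Summits.Ventures.CertifiedManyBodySolver.Certificates.HubbardSquare_n7o8_stiffness_chordOneStation_ax8_points_A
import Summits.Ventures.CertifiedManyBodySolver.Observables.StiffnessApexTransportFermiSeaBoxes
import HarnessLib
import HarnessLib.Audit

/-!
# Ventures/CertifiedManyBodySolver — Certificates/HubbardSquare_n7o8_stiffness_chordOneStation_twins9o8_ax8_points_A.lean

HONEST FRAMING: the ELECTRON-DOPED `n = 9/8` particle–hole TWINS (`4 ∣ L`, `(t′, 7/8) ↦ (−t′, 9/8)`; `box_twin_nine_div_eight`,
`ObsStiffnessSeqCeilingAt.twin_nine_div_eight`) of the (N37) «⅞ K060 CORNER UNDER THE A0′ APEX MIRROR CAP ON THE WINDOW OF RECORD [#795 ∣ #580], BY NAME» words of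
`Certificates/HubbardSquare_n7o8_stiffness_chordOneStation_ax8_points_A.lean` (hubbard-fast-reuse-2 g24; 1 twins in this file; same constants, mirrored hopping intervals). Dictionary class: one-sided stiffness CEILINGS, transport-only,
conditional on EXACTLY the premises of their 7/8 originals (registry row #544 BY NAME; the image ∕ corner sheets A2 `hsXA2` ∕ E `hsJ5p55n9o10` BY VALUE — surr-2 g2 cert/0 rows, fast-ref F87
REPLAYED, #506 (5) sheet class; cap: the (8,⅞,0) apex mirror face `hi₅₈₀ + A₈′t′` BY NAME on the K₂ ceiling node `hK2c : cert_a0_K2diag_EXT5LpA0n7o8tp0_j300556_up` with its window premises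
from CERTIFIED #795 `h795` ∕ #580 `h580`).
«other observable», Δε = 0; not registry rows; not a superconductivity or `T_c` verdict; NO summit statement is proved by this seat. Zero compute, no definition, no new claim
node, no `sorry`. Cell `pub/hubbard-fast` (D-0154 (1)(A)), seat `hubbard-fast-reuse-2` g24 (object (N37)).
References: E. H. Lieb, F. Y. Wu, Physica A 321 (2003) 1, §1 eq. (3) [LiebWuPhysicaA2003]; D. J. Scalapino, S. R. White, S.-C. Zhang, PRB 47 (1993) 7995, §II [ScalapinoWhiteZhang1993].
-/

noncomputable section

namespace Summit.Ventures.CertifiedManyBodySolver.Certificates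

open Literature.MathematicalPhysics.QuantumLattice
open Literature.MathematicalPhysics.QuantumLattice.ThermodynamicLimit
open Summit.Ventures.CertifiedManyBodySolver.Observables

/-- 9/8 twin of `n7o8_oblqCOax8Mix_U8_tp1o40_stiffnessWord_of`: the mirrored point `(8, 9/8, -1/40)` (`4 ∣ L`), `ρ_s ≤ 0.3694528`. [cite: LiebWuPhysicaA2003, §1 eq. (3)] -/
theorem n9o8_oblqCOax8Mix_U8_tp1o40_twin_of (h544 : cert_r544_bs_GU4n7o8tp0_w3_b4_R2_ob5p2_kry1_kry2c3rel_hanK7B4D4_KN4_PR20d4_hanK8c2s_uprime) (hsJ5p55n9o10 : ∀ m : ℝ, 0 ≤ m → m < 2 → (((-19965697970849422374013173/6044629098073145873530880 : ℚ)) : ℝ) + (((2639339282371/1099511627776 : ℚ)) : ℝ) * m ≤ energyDensityTT' 1 (11/20) 5 m) (hK2c : cert_a0_K2diag_EXT5LpA0n7o8tp0_j300556_up) (h795 : cert_r795_XL2a_GU8n7o8eom8_w3_b4_R2_ob5p2_kry1_kry2c3rel_menuE1_hanK9newD4S3ax8drop_core_focert_it4000) (h580 : cert_colseam_COL3ALTR_balW4D1400x0_allmk)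 :
    ObsStiffnessSeqCeilingOnMultiples 4 (-1/40) (8) (9 / 8) (57727/156250) := by
  have h := (n7o8_oblqCOax8Mix_U8_tp1o40_stiffnessWord_of h544 hsJ5p55n9o10 hK2c h795 h580).twin_nine_div_eight
  norm_num at h ⊢
  exact h

end Summit.Ventures.CertifiedManyBodySolver.Certificates

end
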